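import Literature.NumberTheory.Automorphic.HarishChandraStep2GL
import Literature.NumberTheory.Automorphic.AutomorphicRepsGLCuspidalL2Step1
import Literature.NumberTheory.Automorphic.AutomorphicRepsGLCuspidalL2Step3
import Literature.NumberTheory.Automorphic.AutomorphicRepsGLClosureAnalytic
import HarnessLib

/-!
# Borel–Jacquet 4.6 for `GL_n`: the root fact from its current leaves (assembly only)

Topic `NumberTheory/Automorphic`; root of the decomposition of the named fact
`AutomorphicRepsGL.exists_cuspidalRepData_of_L2 hcpt μ` of `AutomorphicRepsGL` (Borel–Jacquet
1979, 4.6 for `GL_n`: every irreducible closed invariant subspace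
`Π ≤ L²_cusp(GL_n(𝔸_K) ⧸ A_G GL_n(K), μ)` comes from a cuspidal automorphic representation datum,
namely `V_Π / 0` with `V_Π = formsOfL2 hcpt μ Π` the span of the automorphic forms `g ↦ f [g⁻¹]`,
`[f] ∈ Π`). The architecture file `AutomorphicRepsGLCuspidalL2` splits it into F1–F4 and proves the
assembly; the siblings decompose the four steps further. This file only records, as ONE proved
implication, the state of the whole tree of reductions, so that the live trust base of the root
can be read (and checked) in one place:

`AutomorphicRepsGL.exists_cuspidalRepData_of_L2_of_leaves` :
  F1a → F1b → (basic estimate on Siegel sets) → (reduction theory) → F1d →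
  (Harish-Chandra's convolution identity) → (cusp forms are bounded) →
  (analyticity of `K`-finite matrix coefficients) → F3b → `exists_cuspidalRepData_of_L2 hcpt μ`.

The nine leaves (all named facts, each a printed theorem; file of residence in brackets):

* Step 1 (`V_Π ≠ 0`; `AutomorphicRepsGL.formsOfL2_ne_bot_of` [`…CuspidalL2Step1`]):
  F1a `AutomorphicRepsGL.exists_kFinite_garding_fixed` (a non-zero `K_∞`-finite `v ∈ Π` with
  `Π(η) v = v`; Getz–Hahn 2024, Lemma 9.8.2), F1b `AutomorphicRepsGL.isArchSmooth_smoothedForm`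
  (Gårding: smoothed forms are archimedean-smooth, `X S_η = S_{η_X}`; Getz–Hahn Prop. 4.2.3, Bump
  (2.28)–(2.29)), `GLnCuspidalSpectrum.norm_smoothedForm_le_of_isSiegelSetGL` (the basic estimate
  (9.13) on a Siegel set; Getz–Hahn Prop. 9.6.1, Garrett Thm. 7.3.10), `reductionTheory_gl`
  (Getz–Hahn Thm. 2.7.2), F1d `AutomorphicRepsGL.exists_infinitesimalCharacter_garding` (`Z(𝔤)`
  acts on Gårding vectors of the irreducible `Π` by a character; Segal–Mautner, Knapp–Vogan 1995,
  Thm. 0.2).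
* Step 2 (`V_Π` is `(𝔤, K_∞) × GL_n(𝔸_K^∞)`-stable; group part proved in `…CuspidalL2Step2`,
  `AutomorphicFormsGLTranslates`, `AutomorphicFormsKTranslates`; Lie part reduced in
  `…CuspidalL2Step2`, `HarishChandraGrowthGL`, `HarishChandraL2GL`, `HarishChandraStep2GL`):
  `AutomorphicRepsGL.exists_convolution_eq_self` (Harish-Chandra's `φ = φ ∗ α`,
  `α ∈ C_c^∞(GL_n(K_∞))`; Harish-Chandra 1966, Thm. 1; Borel 1972, Thm. 3.18)
  [`HarishChandraConvolutionGL`].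
* Step 3 (`V_Π` is irreducible; `AutomorphicRepsGL.formsOfL2_irreducible_of` [`…CuspidalL2Step3`],
  `AutomorphicRepsGL.formsOfL2_closure_exp_invariant_of_coeff_analyticAt`
  [`AutomorphicRepsGLClosureAnalytic`]): `AutomorphicRepsGL.cuspidal_bounded` (`A_G`-invariant
  cusp forms are bounded; Getz–Hahn Thm. 9.8.1) [`AutomorphicRepsGLCuspFormsSquareIntegrable`],
  `AutomorphicRepsGL.formsOfL2_coeff_analyticAt` (matrix coefficients of the classes of `V_Π`
  are real analytic along `exp tX`; Harish-Chandra 1953, Lemma 34) [`…ClosureAnalytic`], F3b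
  `AutomorphicRepsGL.formsOfL2_mem_of_toLp_mem_closure` (`Cl[W] ∩ V_Π = W`; Harish-Chandra 1953,
  Thm. 5 — admissibility of cuspidal `Π`) [`…CuspidalL2Step3`].
* Step 4 (automorphic forms with class in `L²_cusp` are cusp forms) is a theorem
  (`AutomorphicRepsGL.isCuspFormGL_invQuot_of_mem_cuspidalSubspace_holds`, `…CuspidalL2Step4`).

Nothing is defined or restated here; the theorem is a composition of the siblings' assemblies
(`formsOfL2_ne_bot_of`, `exists_cuspidalRepData_of_L2_of_harishChandra`,
`formsOfL2_irreducible_of`, `formsOfL2_closure_exp_invariant_of_coeff_analyticAt`). When the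
leaves are discharged, `exists_cuspidalRepData_of_L2_holds` is this theorem applied to their
`_holds` (or, with Steps 1 and 3 kept whole, `exists_cuspidalRepData_of_L2_of_harishChandra` of
`HarishChandraStep2GL` applied to `formsOfL2_ne_bot_holds`, `exists_convolution_eq_self_holds`,
`formsOfL2_irreducible_holds`).

## References

* A. Borel, H. Jacquet, *Automorphic forms and automorphic representations*, Proc. Sympos. Pure
  Math. 33 (Corvallis 1977), Part 1 (1979), 189–202, §4.6 [BorelJacquet1979] (not held; the
  statement is cross-checked against Getz–Hahn 2024, Thm. 6.5.2, p. 121, and Bump 1997,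
  Thm. 3.3.4, PDF p. 296).
* J. R. Getz, H. Hahn, *An Introduction to Automorphic Representations*, GTM 300 (2024), §6.5,
  §9.6–9.8 [GetzHahn2024].
* Harish-Chandra, *Representations of a semisimple Lie group on a Banach space. I*, Trans. AMS
  75 (1953), Lemma 34, Thm. 5–6 [HarishChandraTAMS1953]; *Discrete series for semisimple Lie
  groups. II*, Acta Math. 116 (1966), Thm. 1 [HarishChandra1966].
-/

noncomputable section

open scoped MatrixGroups
open NumberField _root_.MeasureTheory

namespace Literature.NumberTheory.Automorphic

variable {n : ℕ} {K : Type} [Field K] [NumberField K]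
  {hcpt : isCompact_glFiniteIntegralLevel n K}
  {μ : Measure (AdelicGroupData.gl n K).automorphicQuotient}
  [(AdelicGroupData.gl n K).IsAutomorphicMeasure μ]

/-- **Borel–Jacquet 1979, 4.6 for `GL_n`, from the current leaves of its decomposition.** Every
irreducible closed invariant subspace of `L²_cusp(GL_n(𝔸_K) ⧸ A_G GL_n(K), μ)` comes from a
cuspidal automorphic representation datum (`AutomorphicRepsGL.exists_cuspidalRepData_of_L2 hcpt μ`),
granted: F1a (non-zero `K_∞`-finite Gårding-fixed vectors), F1b (smoothed forms are smooth in the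
archimedean variable), the basic estimate on Siegel sets, reduction theory for `GL_n`, F1d
(infinitesimal character on Gårding vectors), Harish-Chandra's convolution identity `φ = φ ∗ α`,
boundedness of `A_G`-invariant cusp forms, analyticity of the `K`-finite matrix coefficients of
cuspidal `Π`, and F3b (`Cl[W] ∩ V_Π = W` for stable `W ≤ V_Π`). Composition of
`formsOfL2_ne_bot_of` (Step 1), `exists_cuspidalRepData_of_L2_of_harishChandra` (Step 2 from the
convolution identity, with the F1–F4 assembly and the discharged Step 4) and
`formsOfL2_irreducible_of` with `formsOfL2_closure_exp_invariant_of_coeff_analyticAt` (Step 3).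
Borel–Jacquet 1979, 4.6; Getz–Hahn 2024, Thm. 6.5.2; Bump 1997, Thm. 3.3.4.
[cite: BorelJacquet1979, 4.6] -/
theorem AutomorphicRepsGL.exists_cuspidalRepData_of_L2_of_leaves
    (h1a : AutomorphicRepsGL.exists_kFinite_garding_fixed hcpt μ)
    (h1b : AutomorphicRepsGL.isArchSmooth_smoothedForm hcpt μ)
    (hBE : GLnCuspidalSpectrum.norm_smoothedForm_le_of_isSiegelSetGL n K μ)
    (hRT : reductionTheory_gl n K)
    (h1d : AutomorphicRepsGL.exists_infinitesimalCharacter_garding hcpt μ)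
    (hHC : AutomorphicRepsGL.exists_convolution_eq_self hcpt)
    (hbdd : AutomorphicRepsGL.cuspidal_bounded hcpt)
    (hAn : AutomorphicRepsGL.formsOfL2_coeff_analyticAt hcpt μ)
    (h3b : AutomorphicRepsGL.formsOfL2_mem_of_toLp_mem_closure hcpt μ) :
    AutomorphicRepsGL.exists_cuspidalRepData_of_L2 hcpt μ :=
  AutomorphicRepsGL.exists_cuspidalRepData_of_L2_of_harishChandra
    (AutomorphicRepsGL.formsOfL2_ne_bot_of hcpt μ h1a h1b hBE hRT h1d) hHC
    (AutomorphicRepsGL.formsOfL2_irreducible_of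
      (AutomorphicRepsGL.formsOfL2_closure_exp_invariant_of_coeff_analyticAt hbdd hAn) h3b)

end Literature.NumberTheory.Automorphic
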